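/-
Origin: expansion seat `planner-pub-hodgecm-pv07-0`, handover 2026-08-18 (`HOME/pub-hodgecm-pv07/lean/Pv07/PiecesSplit.lean`, md5 31eefc28, 118 lines);
landed by the gen-6 packager in gate run 22 as `HodgeCM/PerL34/LocalFactors/PiecesSplit.lean` (import ^import Pv07\.(BallDichotomy|SplitFactor|CompactFactor|KernelRadius|Dictionary|SmokeSplit|SmokeCompact|PiecesRamPos|PiecesSplit)\b→import HodgeCM.PerL34.LocalFactors.\1 ×1).
-/
/-
Copyright: HodgeCM publication cell (pub-hodgecm), DAG node N31f (prover pv07).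
Released under the package licence.

# N31f → `LocalFactorPieces.ram_pos` BY NAME at the SPLIT places (tex ll. 617–623), modulo the model equation

Companion of `PiecesRamPos` (compact places).  At a split place `v ∈ S` PerL chooses `φ_v = 1_D`,
`D = x₀ + ϖ^N 𝒪³`, and computes in the Schrödinger (dilation) model of `ω_v|U(W_i)`, `U(W_i)(L_{0,v}) = L_{0,v}^×`:
`⟨ω_v(y)φ_v, φ_v⟩ = a(y)·vol(D ∩ y⁻¹D) =: ballCoeff a vol x₀ r y` (l. 611, 621–622).  The kernel theorem
`N31f_core_split_holds` (`HodgeCM.PerL34.LocalFactors`) evaluates the resulting integral.  Here that computation is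
transported onto pv13's consumer structure `EulerFactorisation.LocalIntegrand` (`(loc v).I = Re ∫ ⟪φ, ω(y)φ⟫ χ'(y)`):

* `loc_Ic_eq_of_splitModel`, `loc_I_pos_of_splitModel` : GIVEN a coordinate `e : (loc v).G → F` (`U(W_i)(L_{0,v}) =
  L_{0,v}^× ⊂ L_{0,v} = F`) under which the matrix coefficient of the chosen vector IS the ball coefficient
  (`coeff_eq` — this single equation is the D4 model identification + the choice `φ_v = 1_D`, print: MVW LNM 1291
  ch. 3 §III.1, Kudla 1996 III Rem. 6.3; GAPS pv07-G1) and `χ'_v = χF ∘ e` trivial on `U₁` (l. 620, the "N large"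
  choice — kernel: `LocalFactors.KernelRadius`), one has `I_v = vol(D) · μ_v(e⁻¹ U₁)` and hence `0 < I_v` as soon as
  the Haar measure of the open subgroup `e⁻¹U₁ = U₁ ⊂ L_{0,v}^×` is positive and finite (instantiation facts);
* `HasIsotypicModel`, `HasSplitModel` : the two per-place hypothesis packages as `Prop`s;
* `ram_pos_of_placeModels` : the FIELD SHAPE `∀ v ∈ S, 0 < (loc v).I` from "every `v ∈ S` carries one of the two
  models" — i.e. `LocalFactorPieces.ram_pos` is kernel modulo (D4 model equation at split `v`) + (N27/N31a
  isotypic nonzero vector at compact `v`) + Haar positivity/finiteness, exactly the residuals recorded in LEMMAS §9 S3.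
Nothing cited, nothing asserted.
-/
import Summits.HodgeConjecture.HodgeCM.PerL34.LocalFactors.PiecesRamPos
import Summits.HodgeConjecture.HodgeCM.PerL34.LocalFactors.SplitFactor

/-! PORT of `HodgeCM/PerL34/LocalFactors/PiecesSplit.lean` (HodgeCMPerL run 82) — verbatim mechanical port; provenance in the PORT header line. -/

noncomputable section

open MeasureTheory Metric Set Complex ComplexConjugate
open scoped InnerProductSpace

namespace HodgeCM
namespace PerL34
namespace LocalFactors

open EulerFactorisation

section Split

variable (L : LocalIntegrand)
variable {F : Type} [NormedField F] [IsUltrametricDist F] [ProperSpace F]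
variable {n : ℕ} [MeasurableSpace (Fin n → F)]
variable (μV : Measure (Fin n → F)) [μV.IsOpenPosMeasure] [IsFiniteMeasureOnCompacts μV]
variable {a χF : F → ℂ} {x₀ : Fin n → F} {r : ℝ}

omit [ProperSpace F] [μV.IsOpenPosMeasure] [IsFiniteMeasureOnCompacts μV] in
/-- Under the split model the integrand is `vol(D) · 𝟙_{e⁻¹U₁}` (tex l. 622: "`m = vol(D)𝟙_{U₁}`", and
`χ'_v = 1` on `U₁`, l. 620). -/
theorem loc_f_eq_indicator_of_splitModel (hr : r < ‖x₀‖) (ha : ∀ y ∈ U1 x₀ r, a y = 1)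
    (hχ : ∀ y ∈ U1 x₀ r, χF y = 1) (e : L.G → F)
    (coeff_eq : ∀ y, ⟪L.φ, L.ω y L.φ⟫_ℂ = ballCoeff a μV x₀ r (e y)) (chi_eq : ∀ y, L.χ y = χF (e y)) :
    L.f = (e ⁻¹' U1 x₀ r).indicator fun _ => (μV.real (closedBall x₀ r) : ℂ) := by
  funext y
  unfold LocalIntegrand.f
  rw [coeff_eq y, chi_eq y, ballCoeff_eq_indicator hr ha]
  by_cases hy : e y ∈ U1 x₀ r
  · rw [indicator_of_mem hy, indicator_of_mem (show y ∈ e ⁻¹' U1 x₀ r from hy), hχ _ hy, mul_one]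
  · rw [indicator_of_notMem hy, indicator_of_notMem (show y ∉ e ⁻¹' U1 x₀ r from hy), zero_mul]

omit [ProperSpace F] [μV.IsOpenPosMeasure] [IsFiniteMeasureOnCompacts μV] in
/-- **`I_v = vol(D) · vol(U₁)`** on pv13's structure (tex l. 622–623), `vol(U₁)` read in `U(W_i)(L_{0,v})`. -/
theorem loc_Ic_eq_of_splitModel (hr : r < ‖x₀‖) (ha : ∀ y ∈ U1 x₀ r, a y = 1)
    (hχ : ∀ y ∈ U1 x₀ r, χF y = 1) (e : L.G → F) (he : MeasurableSet (e ⁻¹' U1 x₀ r))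
    (coeff_eq : ∀ y, ⟪L.φ, L.ω y L.φ⟫_ℂ = ballCoeff a μV x₀ r (e y)) (chi_eq : ∀ y, L.χ y = χF (e y)) :
    L.Ic = ((μV.real (closedBall x₀ r) * L.μ.real (e ⁻¹' U1 x₀ r) : ℝ) : ℂ) := by
  unfold LocalIntegrand.Ic
  rw [loc_f_eq_indicator_of_splitModel L μV hr ha hχ e coeff_eq chi_eq, integral_indicator_const _ he,
    Complex.real_smul]
  push_cast
  ring

/-- **N31f at a split place, by name on pv13's structure: `0 < I_v`**, given the model equation and
`0 < vol(U₁) < ∞` in `U(W_i)(L_{0,v})`. -/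
theorem loc_I_pos_of_splitModel (hr : r < ‖x₀‖) (hr0 : 0 < r) (ha : ∀ y ∈ U1 x₀ r, a y = 1)
    (hχ : ∀ y ∈ U1 x₀ r, χF y = 1) (e : L.G → F) (he : MeasurableSet (e ⁻¹' U1 x₀ r))
    (coeff_eq : ∀ y, ⟪L.φ, L.ω y L.φ⟫_ℂ = ballCoeff a μV x₀ r (e y)) (chi_eq : ∀ y, L.χ y = χF (e y))
    (hpos : L.μ (e ⁻¹' U1 x₀ r) ≠ 0) (hfin : L.μ (e ⁻¹' U1 x₀ r) ≠ ⊤) : 0 < L.I := by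
  unfold LocalIntegrand.I
  rw [loc_Ic_eq_of_splitModel L μV hr ha hχ e he coeff_eq chi_eq, Complex.ofReal_re]
  exact mul_pos (measureReal_ball_pos x₀ hr0) (ENNReal.toReal_pos hpos hfin)

end Split

/-! ### The field shape over all of `S` -/

/-- Compact-place package (archimedean / non-split `v ∈ S`): finite Haar measure of nonzero mass, unitary `χ'_v`,
nonzero `χ̄'_v`-isotypic chosen vector (N27 / N31a). -/
def HasIsotypicModel (L : LocalIntegrand) : Prop :=
  IsFiniteMeasure L.μ ∧ L.μ univ ≠ 0 ∧ locIsIsotypic L ∧ (∀ y, ‖L.χ y‖ = 1) ∧ L.φ ≠ 0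

/-- Split-place package (`v ∈ S` split): the D4 model equation for `φ_v = 1_D` in some coordinate
`e : U(W_i)(L_{0,v}) → L_{0,v}`, with `a`, `χ'_v` trivial on `U₁` and `0 < vol(U₁) < ∞`. -/
def HasSplitModel (L : LocalIntegrand) : Prop :=
  ∃ (F : Type) (_ : NormedField F) (_ : IsUltrametricDist F) (_ : ProperSpace F) (n : ℕ)
    (_ : MeasurableSpace (Fin n → F)) (μV : Measure (Fin n → F)) (_ : μV.IsOpenPosMeasure)
    (_ : IsFiniteMeasureOnCompacts μV) (a χF : F → ℂ) (x₀ : Fin n → F) (r : ℝ) (e : L.G → F),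
    r < ‖x₀‖ ∧ 0 < r ∧ (∀ y ∈ U1 x₀ r, a y = 1) ∧ (∀ y ∈ U1 x₀ r, χF y = 1) ∧
      MeasurableSet (e ⁻¹' U1 x₀ r) ∧ (∀ y, ⟪L.φ, L.ω y L.φ⟫_ℂ = ballCoeff a μV x₀ r (e y)) ∧
      (∀ y, L.χ y = χF (e y)) ∧ L.μ (e ⁻¹' U1 x₀ r) ≠ 0 ∧ L.μ (e ⁻¹' U1 x₀ r) ≠ ⊤

/-- (Ported verbatim from the HodgeCMPerL package; no docstring in the source.) -/
theorem loc_I_pos_of_hasIsotypicModel (L : LocalIntegrand) (h : HasIsotypicModel L) : 0 < L.I := by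
  obtain ⟨hfin, hμ, hiso, hχ, hφ⟩ := h
  haveI := hfin
  exact loc_I_pos_of_isotypic L hμ hiso hχ hφ

/-- (Ported verbatim from the HodgeCMPerL package; no docstring in the source.) -/
theorem loc_I_pos_of_hasSplitModel (L : LocalIntegrand) (h : HasSplitModel L) : 0 < L.I := by
  obtain ⟨F, _, _, _, n, _, μV, _, _, a, χF, x₀, r, e, hr, hr0, ha, hχ, he, coeff_eq, chi_eq, hpos, hfin⟩ := h
  exact loc_I_pos_of_splitModel L μV hr hr0 ha hχ e he coeff_eq chi_eq hpos hfin

/-- **`LocalFactorPieces.ram_pos` from the place models** (tex ll. 612–623, all of `S`). -/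
theorem ram_pos_of_placeModels {V : Type} (S : Finset V) (loc : V → LocalIntegrand)
    (h : ∀ v ∈ S, HasIsotypicModel (loc v) ∨ HasSplitModel (loc v)) : ∀ v ∈ S, 0 < (loc v).I :=
  fun v hv => (h v hv).elim (loc_I_pos_of_hasIsotypicModel (loc v)) (loc_I_pos_of_hasSplitModel (loc v))

end LocalFactors
end PerL34
end HodgeCM
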